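import Literature.Probability.Percolation.GladkovZiminKernel
import Mathlib.Tactic.Linarith
import Mathlib.Tactic.Ring
import Mathlib.Tactic.Positivity
import HarnessLib

/-!
# `NoHeavyLowerTail` (stmt-CriticalPhenomena-4575) — Sahi's third functional `E₃` (Richards' conjugate cumulant)
# on the weighted cube is nonnegative when one of the three functions is the indicator of a CYLINDER (principal up-set)

Support file (factory seat prim-ineq-gen-8, gen 3; `--supports stmt-CriticalPhenomena-4575`).  No named facts, no sorries.

Context.  For positive monotone `f g h` on a distributive lattice with an FKG measure, Sahi [Combinatorica 28 (2008),
Conj. 5] conjectured `E_n(f_1,…,f_n) ≥ 0` for the multilinear functionals `E_n := Σ_{σ ∈ S_n} (−1)^{C(σ)−1} Π_{cycles}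
E[Π_{i∈c} f_i]`; `E₂` is the FKG covariance and
`E₃(f,g,h) = 2E[fgh] + Ef·Eg·Eh − Ef·E[gh] − Eg·E[fh] − Eh·E[fg]` is Richards' functional [Ann. Probab. 32 (2004)]
(Richards' proof of `E₃ ≥ 0` has gaps: Sahi 2008, Lieb–Sahi 2022 §1, Gladkov arXiv:2408.08457 Rem. 8.8; the inequality is
open even for product measures on `{0,1}^k`, Gladkov–Zimin 2024 Conj. 2.6).  The cubic "E3GRP" rows that numerically close
the SHK3⁺ terminal-edge Bernstein step of this route (harness-2 / ttrl2 2026-08-19) are instances of `E₃ ≥ 0` for three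
group-separation events, and SHK3⁺ = 3PT-LB is `E₃ ≥ 0` for the three pairwise disconnections of three terminals.

This file proves the CYLINDER CASE on the weighted cube (`wtW`, `ED` of `Literature.Probability.Percolation.DecisionTree`,
arbitrary coordinate probabilities `p ∈ [0,1]^ι`): if `u = 1[a ⊆ S]` is the indicator of a principal up-set and `f, g` are
monotone and nonnegative, then `E₃(u, f, g) ≥ 0`.  (Lieb–Sahi 2022 Thm 3.5 needs ALL functions to be rectangle indicators;
here the other two are arbitrary.)  Proof: conditioning on the cylinder is again a weighted cube (`ED_cylinder_mul`),
conditioning on a cylinder raises monotone expectations (`ED_le_ED_cylinder`), Harris on the conditioned cube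
(`ED_mul_ED_le_ED_mul`, from Gladkov–Zimin Thm 2.1 `ED_ED_le_ED_diag`), and the two-line estimate
`2X + FG − AG − BF − E[fg] ≥ X + FG − AG − BF ≥ AB + FG − AG − BF = (A − F)(B − G) ≥ 0`
(`X = E′[f_a g_a] ≥ AB`, `A = E′f_a ≥ F = Ef`, `B = E′g_a ≥ G = Eg`, `E[fg] ≤ X`).

* `ED_one`, `ED_congr_sub`, `ED_cylinder_mul`, `ED_le_ED_cylinder`, `ED_mul_ED_le_ED_mul` — the four lemmas above;
* **`sahiE3_cylinder_nonneg`** — `0 ≤ E₃(1[a ⊆ ·], f, g)` on the cube `a ∪ D` (`a`, `D` disjoint), `f, g ≥ 0` monotone.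
-/

noncomputable section

namespace Summit.CriticalPhenomena.PercolationContinuityZ3.Theorems

open Finset Literature.Probability.Percolation Literature.Probability.Percolation.DecisionTree

variable {ι : Type*} [DecidableEq ι]

/-- The weighted cube has total mass one: `ED D p 1 = 1`. [folklore] -/
theorem ED_one (D : Finset ι) (p : ι → ℝ) : ED D p (fun _ => (1 : ℝ)) = 1 := by
  unfold ED
  simp only [mul_one]
  exact sum_wtW D p

/-- `ED` only sees the values on sub-configurations of `D`. [folklore] -/
theorem ED_congr_sub (D : Finset ι) (p : ι → ℝ) {φ ψ : Finset ι → ℝ} (h : ∀ S, S ⊆ D → φ S = ψ S) :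
    ED D p φ = ED D p ψ := by
  unfold ED
  exact Finset.sum_congr rfl fun S hS => by rw [h S (Finset.mem_powerset.1 hS)]

/-- **Conditioning on a cylinder.**  On the cube `a ∪ D` (`a ∩ D = ∅`), integrating against the indicator of the
principal up-set `{S ⊇ a}` factors as `∏_{i∈a} p_i` times the expectation, on the cube `D`, of the section `S ↦ φ (a ∪ S)`.
[folklore] -/
theorem ED_cylinder_mul (a D : Finset ι) (had : Disjoint a D) (p : ι → ℝ) (φ : Finset ι → ℝ) :
    ED (a ∪ D) p (fun S => if a ⊆ S then φ S else 0) = (∏ i ∈ a, p i) * ED D p (fun S => φ (a ∪ S)) := by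
  induction a using Finset.induction_on generalizing φ with
  | empty =>
    simp only [Finset.empty_union, Finset.empty_subset, if_true, Finset.prod_empty, one_mul]
  | @insert e a' hea ih =>
    have heD : e ∉ D := fun h => (Finset.disjoint_left.1 had (Finset.mem_insert_self e a')) h
    have had' : Disjoint a' D := Finset.disjoint_of_subset_left (Finset.subset_insert e a') had
    have heaD : e ∉ a' ∪ D := by
      rw [Finset.mem_union, not_or]; exact ⟨hea, heD⟩
    rw [Finset.insert_union, ED_insert p heaD, Finset.prod_insert hea]
    -- the section avoiding `e` vanishes
    have h0 : ED (a' ∪ D) p (fun S => if insert e a' ⊆ S then φ S else 0) = ED (a' ∪ D) p (fun _ => (0 : ℝ)) := by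
      refine ED_congr_sub _ _ fun S hS => ?_
      have heS : e ∉ S := fun h => heaD (hS h)
      have : ¬ insert e a' ⊆ S := fun h => heS (h (Finset.mem_insert_self e a'))
      rw [if_neg this]
    have h0' : ED (a' ∪ D) p (fun _ => (0 : ℝ)) = 0 := by
      have := ED_mul_left (a' ∪ D) p 0 (fun _ => (1 : ℝ))
      simpa using this
    -- the section through `e` is the cylinder of `a'` for the shifted function
    have h1 : ED (a' ∪ D) p (fun S => if insert e a' ⊆ insert e S then φ (insert e S) else 0) =
        ED (a' ∪ D) p (fun S => if a' ⊆ S then φ (insert e S) else 0) := by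
      refine ED_congr_sub _ _ fun S hS => ?_
      have heS : e ∉ S := fun h => heaD (hS h)
      have hiff : insert e a' ⊆ insert e S ↔ a' ⊆ S := by
        constructor
        · intro h x hx
          have hx' : x ∈ insert e S := h (Finset.mem_insert_of_mem hx)
          rcases Finset.mem_insert.1 hx' with hxe | hxS
          · exact absurd (hxe ▸ hx) hea
          · exact hxS
        · intro h
          exact Finset.insert_subset_insert e h
      simp only [hiff]
    rw [h0, h0', h1, ih had' (fun S => φ (insert e S))]
    have hins : ∀ S, insert e (a' ∪ S) = insert e a' ∪ S := fun S => by
      rw [Finset.insert_union]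
    simp only [hins]
    ring

/-- **Conditioning on a cylinder raises monotone expectations**: for `φ` monotone along `⊆` and `p ∈ [0,1]`,
`E_{a ∪ D} φ ≤ E_D φ(a ∪ ·)` (Harris' inequality with a principal up-set, in elementary form). [folklore] -/
theorem ED_le_ED_cylinder (a D : Finset ι) (had : Disjoint a D) {p : ι → ℝ} (hp0 : ∀ i, 0 ≤ p i)
    (hp1 : ∀ i, p i ≤ 1) {φ : Finset ι → ℝ} (hφ : ∀ ⦃S T : Finset ι⦄, S ⊆ T → φ S ≤ φ T) :
    ED (a ∪ D) p φ ≤ ED D p (fun S => φ (a ∪ S)) := by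
  induction a using Finset.induction_on generalizing φ with
  | empty => simp only [Finset.empty_union, le_refl]
  | @insert e a' hea ih =>
    have heD : e ∉ D := fun h => (Finset.disjoint_left.1 had (Finset.mem_insert_self e a')) h
    have had' : Disjoint a' D := Finset.disjoint_of_subset_left (Finset.subset_insert e a') had
    have heaD : e ∉ a' ∪ D := by
      rw [Finset.mem_union, not_or]; exact ⟨hea, heD⟩
    rw [Finset.insert_union, ED_insert p heaD]
    have hq0 : 0 ≤ p e := hp0 e
    have hq1 : 0 ≤ 1 - p e := sub_nonneg.2 (hp1 e)
    -- compare the `e ∉ S` section with the `e ∈ S` section pointwise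
    have hsec : ED (a' ∪ D) p φ ≤ ED (a' ∪ D) p (fun S => φ (insert e S)) :=
      ED_mono _ hp0 hp1 fun S _ => hφ (Finset.subset_insert e S)
    have hmono' : ∀ ⦃S T : Finset ι⦄, S ⊆ T → φ (insert e S) ≤ φ (insert e T) :=
      fun S T hST => hφ (Finset.insert_subset_insert e hST)
    have hih := ih had' hmono'
    have hins : ∀ S, insert e (a' ∪ S) = insert e a' ∪ S := fun S => by rw [Finset.insert_union]
    simp only [hins] at hih
    calc (1 - p e) * ED (a' ∪ D) p φ + p e * ED (a' ∪ D) p (fun S => φ (insert e S))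
        ≤ (1 - p e) * ED (a' ∪ D) p (fun S => φ (insert e S)) + p e * ED (a' ∪ D) p (fun S => φ (insert e S)) := by
          nlinarith [mul_le_mul_of_nonneg_left hsec hq1]
      _ = ED (a' ∪ D) p (fun S => φ (insert e S)) := by ring
      _ ≤ ED D p (fun S => φ (insert e a' ∪ S)) := hih

/-- **Harris' inequality on the weighted cube, functional form**: for `f, g` monotone along `⊆` and `p ∈ [0,1]`,
`E f · E g ≤ E (f g)` (Gladkov–Zimin Thm 2.1 for the kernel `(S,T) ↦ f S · g T`).
[cite: GladkovZimin2024HK, Thm. 2.2] -/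
theorem ED_mul_ED_le_ED_mul (D : Finset ι) {p : ι → ℝ} (hp0 : ∀ i, 0 ≤ p i) (hp1 : ∀ i, p i ≤ 1)
    {f g : Finset ι → ℝ} (hf : ∀ ⦃S T : Finset ι⦄, S ⊆ T → f S ≤ f T)
    (hg : ∀ ⦃S T : Finset ι⦄, S ⊆ T → g S ≤ g T) :
    ED D p f * ED D p g ≤ ED D p (fun S => f S * g S) := by
  have h := ED_ED_le_ED_diag D hp0 hp1 (fun S T => f S * g T) (by
    intro x y z t hxy hzt
    nlinarith [mul_nonneg (sub_nonneg.2 (hf hxy)) (sub_nonneg.2 (hg hzt))])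
  have hinner : ∀ S, ED D p (fun T => f S * g T) = f S * ED D p g := fun S => ED_mul_left D p (f S) g
  have hrw : ED D p (fun S => ED D p (fun T => f S * g T)) = ED D p g * ED D p f := by
    rw [show (fun S => ED D p (fun T => f S * g T)) = (fun S => ED D p g * f S) from
      funext fun S => by rw [hinner S, mul_comm]]
    exact ED_mul_left D p (ED D p g) f
  rw [hrw] at h
  linarith [h, mul_comm (ED D p f) (ED D p g)]

/-- **Sahi's `E₃ ≥ 0` (Richards' inequality) when one function is a cylinder indicator.**  On the weighted cube on
`a ∪ D` (`a ∩ D = ∅`, coordinate probabilities `p ∈ [0,1]`), for `u = 1[a ⊆ S]` and `f, g` monotone along `⊆` and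
nonnegative:  `2E[ufg] + Eu·Ef·Eg − Eu·E[fg] − Ef·E[ug] − Eg·E[uf] ≥ 0`.
Proof: `E[u·φ] = (∏_{a} p)·E′[φ_a]` with `φ_a := φ(a ∪ ·)` on the cube `D`; with `X = E′[f_a g_a] ≥ E′f_a·E′g_a =: AB`
(Harris), `A ≥ F := Ef`, `B ≥ G := Eg`, `E[fg] ≤ X` (conditioning on a cylinder raises monotone expectations):
`2X + FG − AG − BF − E[fg] ≥ X + FG − AG − BF ≥ (A−F)(B−G) ≥ 0`.  [original; partial case of Sahi 2008 Conj. 5 / Richards 2004] -/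
theorem sahiE3_cylinder_nonneg (a D : Finset ι) (had : Disjoint a D) {p : ι → ℝ} (hp0 : ∀ i, 0 ≤ p i)
    (hp1 : ∀ i, p i ≤ 1) {f g : Finset ι → ℝ} (hf : ∀ ⦃S T : Finset ι⦄, S ⊆ T → f S ≤ f T)
    (hg : ∀ ⦃S T : Finset ι⦄, S ⊆ T → g S ≤ g T) (hf0 : ∀ S, 0 ≤ f S) (hg0 : ∀ S, 0 ≤ g S) :
    0 ≤ 2 * ED (a ∪ D) p (fun S => (if a ⊆ S then (1 : ℝ) else 0) * f S * g S)
          + ED (a ∪ D) p (fun S => if a ⊆ S then (1 : ℝ) else 0) * ED (a ∪ D) p f * ED (a ∪ D) p g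
          - ED (a ∪ D) p (fun S => if a ⊆ S then (1 : ℝ) else 0) * ED (a ∪ D) p (fun S => f S * g S)
          - ED (a ∪ D) p f * ED (a ∪ D) p (fun S => (if a ⊆ S then (1 : ℝ) else 0) * g S)
          - ED (a ∪ D) p g * ED (a ∪ D) p (fun S => (if a ⊆ S then (1 : ℝ) else 0) * f S) := by
  -- abbreviations
  set w : ℝ := ∏ i ∈ a, p i with hw_def
  have hw : 0 ≤ w := Finset.prod_nonneg fun i _ => hp0 i
  set X : ℝ := ED D p (fun S => f (a ∪ S) * g (a ∪ S)) with hX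
  set A : ℝ := ED D p (fun S => f (a ∪ S)) with hA
  set B : ℝ := ED D p (fun S => g (a ∪ S)) with hB
  set F : ℝ := ED (a ∪ D) p f with hF
  set G : ℝ := ED (a ∪ D) p g with hG
  set FG : ℝ := ED (a ∪ D) p (fun S => f S * g S) with hFG
  -- the three cylinder integrals
  have hu : ED (a ∪ D) p (fun S => if a ⊆ S then (1 : ℝ) else 0) = w := by
    have := ED_cylinder_mul a D had p (fun _ => (1 : ℝ))
    rw [this, ED_one, mul_one]
  have hufg : ED (a ∪ D) p (fun S => (if a ⊆ S then (1 : ℝ) else 0) * f S * g S) = w * X := by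
    have := ED_cylinder_mul a D had p (fun S => f S * g S)
    rw [← this]
    refine ED_congr_sub _ _ fun S _ => ?_
    split_ifs <;> ring
  have huf : ED (a ∪ D) p (fun S => (if a ⊆ S then (1 : ℝ) else 0) * f S) = w * A := by
    have := ED_cylinder_mul a D had p f
    rw [← this]
    refine ED_congr_sub _ _ fun S _ => ?_
    split_ifs <;> ring
  have hug : ED (a ∪ D) p (fun S => (if a ⊆ S then (1 : ℝ) else 0) * g S) = w * B := by
    have := ED_cylinder_mul a D had p g
    rw [← this]
    refine ED_congr_sub _ _ fun S _ => ?_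
    split_ifs <;> ring
  -- the four inequalities
  have hfa : ∀ ⦃S T : Finset ι⦄, S ⊆ T → f (a ∪ S) ≤ f (a ∪ T) :=
    fun S T hST => hf (Finset.union_subset_union (subset_refl a) hST)
  have hga : ∀ ⦃S T : Finset ι⦄, S ⊆ T → g (a ∪ S) ≤ g (a ∪ T) :=
    fun S T hST => hg (Finset.union_subset_union (subset_refl a) hST)
  have hfg : ∀ ⦃S T : Finset ι⦄, S ⊆ T → f S * g S ≤ f T * g T :=
    fun S T hST => mul_le_mul (hf hST) (hg hST) (hg0 S) (hf0 T)
  have h1 : A * B ≤ X := ED_mul_ED_le_ED_mul D hp0 hp1 hfa hga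
  have h2 : F ≤ A := ED_le_ED_cylinder a D had hp0 hp1 hf
  have h3 : G ≤ B := ED_le_ED_cylinder a D had hp0 hp1 hg
  have h4 : FG ≤ X := ED_le_ED_cylinder a D had hp0 hp1 hfg
  have key : 0 ≤ 2 * X + F * G - A * G - B * F - FG := by
    nlinarith [mul_nonneg (sub_nonneg.2 h2) (sub_nonneg.2 h3)]
  -- assemble
  rw [hufg, hu, huf, hug]
  have heq : 2 * (w * X) + w * F * G - w * FG - F * (w * B) - G * (w * A) =
      w * (2 * X + F * G - A * G - B * F - FG) := by ring
  rw [heq]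
  exact mul_nonneg hw key

end Summit.CriticalPhenomena.PercolationContinuityZ3.Theorems

end
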